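import Literature.Probability.LatticeModels.DirInvCorrLength
import HarnessLib

/-!
# Ornstein–Zernike asymptotics of the subcritical Ising two-point function (Campanino–Ioffe–Velenik 2003)

Topic `Probability/LatticeModels`.  One NAMED FACT (not proved here), the `d = 3` nearest-neighbour
case of the main theorem of

* M. Campanino, D. Ioffe, Y. Velenik, *Ornstein–Zernike theory for finite range Ising models above
  `T_c`*, Probab. Theory Relat. Fields 125 (2003) 305–349 (arXiv:math/0111274), §1.2 Theorem A
  ("Theorem 1" of the arXiv rendering), eq. (1.3): for `β < β_c`, uniformly as `|x| → ∞`,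
  `⟨σ₀σ_x⟩_β = Φ_β(n_x) |x|^{-(d−1)/2} e^{−|x| ξ_β(n_x)} (1 + o(1))`, `n_x = x/|x|`, with `Φ_β` a
  strictly positive locally analytic function on `𝕊^{d−1}`; §1.1 eqs. (1.1)–(1.2) for the inverse
  correlation length `ξ_β(x) = −lim_k k⁻¹ log ⟨σ₀σ_{[kx]}⟩_β`, a convex, positively homogeneous,
  strictly positive (for `β < β_c`, Aizenman–Barsky–Fernández = their Thm. 1.1) function, i.e. an
  equivalent norm on `ℝ^d`; and Theorem B / abstract: "`ξ_β` is an analytic and strictly convex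
  function of direction".  [CampaninoIoffeVelenik2003]

## Design

* `CIVOrnsteinZernikeAsymptotics3` records, for every `0 < β < β_c(3)` (`criticalBeta 3`), the
  existence of the rate function `ξ : ℝ³ → ℝ` and the prefactor `Φ : ℝ³ → ℝ` with the properties a
  lattice-analysis consumer needs and the paper proves: `ξ` positively `1`-homogeneous, strictly
  positive off `0`, `C¹` on `ℝ³ ∖ {0}` (the paper has real analyticity — weaker is recorded), and
  equal on lattice vectors to the tree's `dirInvCorrLength 3 β` (`DirInvCorrLength.lean`, which is
  CIV's (1.1) restricted to `ℤ³`, where the integer part is the identity); `Φ` the degree-zero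
  homogeneous extension of `Φ_β`, strictly positive and continuous off `0` (the paper has local
  analyticity on `𝕊²`); and the asymptotics in RATIO form along the cofinite filter of `ℤ³`,
  `⟨σ₀σ_x⟩⁺_β · |x| · e^{ξ(x)} / Φ(x) → 1` (`|·|` Euclidean, written `√(∑ xⱼ²)`; "uniformly in
  `|x| → ∞`" is exactly cofinite convergence since balls of `ℤ³` are finite).  Below `β_c` the
  Gibbs state is unique, so the paper's `⟨·⟩_β` is the plus state `twoPointPlus 3 β`.
* Consumer: `Summits/CriticalPhenomena/Ising3DConformalLimit/Theorems/
  PerfectScreeningSubharmonicOffOriginMassiveRegime.lean`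
  (`subcritical_eventually_strictSubharmonic_of_OZ`, whose hypothesis is this definiens verbatim):
  OZ asymptotics force eventual uniformly strict lattice subharmonicity of `⟨σ₀σ_x⟩⁺_β`.
* Deliberately NOT here: general dimension `d` and general finite-range interactions `J` (the tree's
  plus state `twoPointPlus d β` is nearest-neighbour); analyticity of `ξ_β`, `Φ_β`; Theorem B proper
  (locally analytic strictly convex boundary of the dual body `K_β` with uniformly positive Gaussian
  curvature); the strict triangle inequality.
  -- TODO(general form): all of the above.

## References

* [CampaninoIoffeVelenik2003] M. Campanino, D. Ioffe, Y. Velenik, PTRF 125 (2003) 305–349,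
  doi:10.1007/s00440-002-0229-z, arXiv:math/0111274 — §1.1 (1.1)–(1.2), Thm. 1.1; §1.2 Thm. A
  (1.3), Thm. B; abstract.
-/

noncomputable section

open Filter
open scoped _root_.Topology

namespace Literature.Probability.LatticeModels

/-- **Ornstein–Zernike asymptotics of the subcritical two-point function of the nearest-neighbour
Ising model on `ℤ³`** (Campanino–Ioffe–Velenik 2003, §1.2 Thm. A, eq. (1.3), with §1.1
eqs. (1.1)–(1.2) and Thm. B / abstract for the regularity of `ξ_β`; special case `d = 3`, range one,
`C¹` in place of analytic).  For every `0 < β < β_c(3)` there are `ξ Φ : ℝ³ → ℝ` with: `ξ` positively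
homogeneous of degree one, strictly positive off the origin, `C¹` on `ℝ³ ∖ {0}`, and
`ξ(x) = dirInvCorrLength 3 β x` for `x ∈ ℤ³` (the inverse correlation length, eq. (1.1)); `Φ`
invariant under positive dilations, strictly positive and continuous off the origin (the prefactor
`Φ_β(x/|x|)`); and `⟨σ₀σ_x⟩⁺_β · |x| · e^{ξ(x)} / Φ(x) → 1` as `x → ∞` in `ℤ³` (cofinite filter;
`|x| = √(∑ⱼ xⱼ²)`), i.e. `⟨σ₀σ_x⟩_β = Φ_β(n_x) |x|^{-1} e^{−ξ_β(x)} (1 + o(1))` uniformly in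
`|x| → ∞`. [cite: CampaninoIoffeVelenik2003, §1.2 Thm. A (arXiv: Theorem 1), eq. (1.3); §1.1 eqs. (1.1)–(1.2); Thm. B and abstract] -/
def CIVOrnsteinZernikeAsymptotics3 : Prop :=
  ∀ β : ℝ, 0 < β → β < criticalBeta 3 →
    ∃ ξ Φ : (Fin 3 → ℝ) → ℝ,
      (∀ c : ℝ, 0 < c → ∀ y, ξ (c • y) = c * ξ y) ∧
      (∀ y, y ≠ 0 → 0 < ξ y) ∧
      ContDiffOn ℝ 1 ξ {0}ᶜ ∧
      (∀ x : Site 3, ξ (fun j => (x j : ℝ)) = dirInvCorrLength 3 β x) ∧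
      (∀ c : ℝ, 0 < c → ∀ y, Φ (c • y) = Φ y) ∧
      (∀ y, y ≠ 0 → 0 < Φ y) ∧
      ContinuousOn Φ {0}ᶜ ∧
      Tendsto (fun x : Site 3 => twoPointPlus 3 β x * Real.sqrt (∑ j, ((x j : ℝ)) ^ 2) *
        Real.exp (ξ (fun j => (x j : ℝ))) / Φ (fun j => (x j : ℝ))) cofinite (𝓝 1)

end Literature.Probability.LatticeModels
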